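import Summits.CriticalPhenomena.PercolationContinuityZ3.Theorems.PercAnnulusCrossingIICAnnulusNonUniqueness
import Summits.CriticalPhenomena.PercolationContinuityZ3.Theorems.PercAnnulusCrossingUniformUniqZone
import Literature.Probability.Percolation.SeedLemma
import HarnessLib

/-!
# Kesten–Basu–Sapozhnikov IIC scheme in boxes, NEAR-CRITICAL series VII: the annulus non-uniqueness event decreases in the outer radius,
# and closing the inner box turns it into a bad pair of the uniqueness zone (lane RSW3, p1 gen 6)

builds on p205010 (kernel theorem, internal audit signed; external expert review pending)

Seat `prim-rsw3-p1` (gen 6).  Deterministic (configuration-wise) facts about the annulus-intrinsic non-uniqueness event `NONUNIQ(a,b)` of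
parts V/VI (two open crossings of `Λ(b) ∖ Λ(a)` through the pair set `EANN(a,b)`, not joined through `EANN(a,b)`; Basu–Sapozhnikov's `E_2`),
used by series VIII to show that its probability tends to `0` at every `p < 1`, uniformly on compacts (their (3) ⇐ (A1)).  Helper file; no
definitions, no sorries; every `d`.
* `exists_eann_prefix` — an `EANN(a,b')`-connection from inside `Λ(b−1)` to outside passes `∂ⁱⁿΛ(b)`, with an `EANN(a,b)` initial piece;
* **`nonuniq_anti`** — `NONUNIQ(a,b') ⊆ NONUNIQ(a,b)` for `a + 1 ≤ b ≤ b'` (lattice configurations);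
* **`exists_badPair_of_nonuniq_of_closed`** — on `NONUNIQ(a, c+1) ∩ {pairs of Λ(a) closed}` (`a ≤ c`) some pair `t₁, t₂ ∈ ∂ⁱⁿΛ(a)` is a
  `badPair c t₁ t₂` of the uniqueness zone (`UniquenessZone.lean`): the finite-energy direction of Basu–Sapozhnikov's "(3) ⟺ (A1)".
References: D. Basu, A. Sapozhnikov, ECP 22 (2017) no. 26, §1 eqs. (3)–(4); S. Martineau, V. Tassion, Ann. Probab. 45 (2017), proof of
Lemma 3.7; G. Grimmett, *Percolation* (1999), §8.2.
-/

noncomputable section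

namespace Summit.CriticalPhenomena.PercolationContinuityZ3.Theorems.Crossing

open MeasureTheory Filter Topology Literature.Probability.Percolation Literature.Probability.LatticeModels
open Literature.Probability.Percolation.DCT16 Literature.Probability.Percolation.DKT20
open Summit.CriticalPhenomena.PercolationContinuityZ3.Theorems.SurfaceTension
open scoped Literature.Probability.Percolation

variable {d : ℕ}

/-! ## Stopping an `EANN(a,b')`-crossing at `∂ⁱⁿΛ(b)` -/

/-- An open `EANN(a,b')`-connection inside `Λ(b')` from `t ∈ Λ(b−1)` to a site `w' ∉ Λ(b−1)` passes through some `u ∈ ∂ⁱⁿΛ(b)`, and its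
initial piece is an open `EANN(a,b)`-connection inside `Λ(b)` (`1 ≤ b`, lattice configuration). [folklore] -/
theorem exists_eann_prefix {a b b' : ℕ} (hb : 1 ≤ b) {ω : BondConfig (Site d)} (hω : ω ⊆ (zdGraph d).edgeSet)
    {t w' : Site d} (ht : t ∈ box d (b - 1)) (hw' : w' ∉ box d (b - 1))
    (h : ω ∩ {e : Sym2 (Site d) | e ∈ (↑((box d b').sym2) : Set (Sym2 (Site d))) ∧
        ¬ (∀ v ∈ e, v ∈ box d a) ∧ ¬ (∀ v ∈ e, v ∈ innerBoundary (zdGraph d) (box d b'))} ∈ openConnIn (↑(box d b') : Set (Site d)) t w') :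
    ∃ u ∈ innerBoundary (zdGraph d) (box d b),
      ω ∩ {e : Sym2 (Site d) | e ∈ (↑((box d b).sym2) : Set (Sym2 (Site d))) ∧
        ¬ (∀ v ∈ e, v ∈ box d a) ∧ ¬ (∀ v ∈ e, v ∈ innerBoundary (zdGraph d) (box d b))} ∈ openConnIn (↑(box d b) : Set (Site d)) t u ∧
      ω ∩ {e : Sym2 (Site d) | e ∈ (↑((box d b').sym2) : Set (Sym2 (Site d))) ∧
        ¬ (∀ v ∈ e, v ∈ box d a) ∧ ¬ (∀ v ∈ e, v ∈ innerBoundary (zdGraph d) (box d b'))} ∈ openConnIn (↑(box d b') : Set (Site d)) t u := by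
  classical
  have hωE : ω ∩ {e : Sym2 (Site d) | e ∈ (↑((box d b').sym2) : Set (Sym2 (Site d))) ∧
        ¬ (∀ v ∈ e, v ∈ box d a) ∧ ¬ (∀ v ∈ e, v ∈ innerBoundary (zdGraph d) (box d b'))} ⊆ (zdGraph d).edgeSet := fun e he => hω he.1
  obtain ⟨q, hqS, hqE⟩ := exists_walk_of_mem_openConnIn hωE h
  obtain ⟨a₀, c, q₁, r, hadj, ha₀, hc, hq₁B, hq₁q, hrq, hedges⟩ :=
    exists_cut_walk_edge (↑(box d (b - 1)) : Set (Site d)) q (Finset.mem_coe.2 ht) (fun h' => hw' (Finset.mem_coe.1 h'))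
  have ha₀' : a₀ ∈ box d (b - 1) := Finset.mem_coe.1 ha₀
  have hcb : c ∈ box d b := by
    have := mem_box_succ_of_adj_box hadj ha₀'
    rwa [Nat.sub_add_cancel hb] at this
  have hcB : c ∈ innerBoundary (zdGraph d) (box d b) :=
    mem_innerBoundary_box_of_notMem_pred hb hcb (fun h' => hc (Finset.mem_coe.2 h'))
  -- edges of the prefix (and the exit edge) are edges of `q`
  have hsub : ∀ e ∈ (q₁.concat hadj).edges, e ∈ q.edges := by
    intro e he
    rw [SimpleGraph.Walk.edges_concat, List.concat_eq_append] at he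
    rw [hedges]
    rcases List.mem_append.1 he with he | he
    · exact List.mem_append.2 (Or.inl he)
    · rw [List.mem_singleton] at he
      exact List.mem_append.2 (Or.inr (he ▸ List.mem_cons_self))
  -- every edge of the prefix has an endpoint in `Λ(b−1)` and both endpoints in `Λ(b)`
  have hends : ∀ e ∈ (q₁.concat hadj).edges, (∃ v ∈ e, v ∈ box d (b - 1)) ∧ ∀ v ∈ e, v ∈ box d b := by
    intro e he
    rw [SimpleGraph.Walk.edges_concat, List.concat_eq_append] at he
    rcases List.mem_append.1 he with he | he
    · induction e using Sym2.ind with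
      | h x y =>
        have hx : x ∈ box d (b - 1) := Finset.mem_coe.1 (hq₁B x (q₁.fst_mem_support_of_mem_edges he))
        have hy : y ∈ box d (b - 1) := Finset.mem_coe.1 (hq₁B y (q₁.snd_mem_support_of_mem_edges he))
        refine ⟨⟨x, Sym2.mem_mk_left x y, hx⟩, fun v hv => ?_⟩
        rcases Sym2.mem_iff.1 hv with rfl | rfl
        · exact box_mono d (Nat.sub_le b 1) hx
        · exact box_mono d (Nat.sub_le b 1) hy
    · rw [List.mem_singleton] at he
      subst he
      refine ⟨⟨a₀, Sym2.mem_mk_left a₀ c, ha₀'⟩, fun v hv => ?_⟩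
      rcases Sym2.mem_iff.1 hv with rfl | rfl
      · exact box_mono d (Nat.sub_le b 1) ha₀'
      · exact hcb
  have hsupp : ∀ z ∈ (q₁.concat hadj).support, z ∈ (↑(box d b) : Set (Site d)) := by
    intro z hz
    rw [SimpleGraph.Walk.support_concat, List.mem_append, List.mem_singleton] at hz
    rcases hz with hz | rfl
    · exact Finset.mem_coe.2 (box_mono d (Nat.sub_le b 1) (Finset.mem_coe.1 (hq₁B z hz)))
    · exact Finset.mem_coe.2 hcb
  refine ⟨c, hcB, mem_openConnIn_of_walk (q₁.concat hadj) hsupp (fun e he => ?_),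
    mem_openConnIn_of_walk (q₁.concat hadj) (fun z hz => ?_) (fun e he => hqE e (hsub e he))⟩
  · have heq := hqE e (hsub e he)
    obtain ⟨⟨v₀, hv₀e, hv₀⟩, hall⟩ := hends e he
    refine ⟨heq.1, Finset.mem_coe.2 (Finset.mem_sym2_iff.2 fun v hv => hall v hv), heq.2.2.1, fun hbd => ?_⟩
    exact notMem_box_of_mem_innerBoundary_box (Nat.sub_lt hb Nat.one_pos) (hbd v₀ hv₀e) hv₀
  · rw [SimpleGraph.Walk.support_concat, List.mem_append, List.mem_singleton] at hz
    rcases hz with hz | rfl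
    · exact hqS z (hq₁q z hz)
    · exact hqS _ (hrq _ r.start_mem_support)

/-- **`NONUNIQ(a,b') ⊆ NONUNIQ(a,b)` for `a + 1 ≤ b ≤ b'`** (lattice configurations): stop the two `EANN(a,b')`-crossings at their first
arrivals `u₁, u₂` on `∂ⁱⁿΛ(b)`; an `EANN(a,b)`-connection between `u₁` and `u₂` would join the two original crossings through `EANN(a,b')`.
[cite: BasuSapozhnikov2017ECP, §1 (E_2(v,m,n) is monotone decreasing in n)] -/
theorem nonuniq_anti {a b b' : ℕ} (hab : a + 1 ≤ b) (hbb' : b ≤ b') {ω : BondConfig (Site d)} (hω : ω ⊆ (zdGraph d).edgeSet)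
    (h : ω ∈
      {ω : BondConfig (Site d) | ∃ t₁ ∈ innerBoundary (zdGraph d) (box d a), ∃ w₁ ∈ innerBoundary (zdGraph d) (box d b'),
          ∃ t₂ ∈ innerBoundary (zdGraph d) (box d a), ∃ w₂ ∈ innerBoundary (zdGraph d) (box d b'),
          ω ∩ {e : Sym2 (Site d) | e ∈ (↑((box d b').sym2) : Set (Sym2 (Site d))) ∧
              ¬ (∀ v ∈ e, v ∈ box d a) ∧ ¬ (∀ v ∈ e, v ∈ innerBoundary (zdGraph d) (box d b'))} ∈
            openConnIn (↑(box d b') : Set (Site d)) t₁ w₁ ∧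
          ω ∩ {e : Sym2 (Site d) | e ∈ (↑((box d b').sym2) : Set (Sym2 (Site d))) ∧
              ¬ (∀ v ∈ e, v ∈ box d a) ∧ ¬ (∀ v ∈ e, v ∈ innerBoundary (zdGraph d) (box d b'))} ∈
            openConnIn (↑(box d b') : Set (Site d)) t₂ w₂ ∧
          ω ∩ {e : Sym2 (Site d) | e ∈ (↑((box d b').sym2) : Set (Sym2 (Site d))) ∧
              ¬ (∀ v ∈ e, v ∈ box d a) ∧ ¬ (∀ v ∈ e, v ∈ innerBoundary (zdGraph d) (box d b'))} ∉
            openConnIn (↑(box d b') : Set (Site d)) w₁ w₂}) :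
    ω ∈
      {ω : BondConfig (Site d) | ∃ t₁ ∈ innerBoundary (zdGraph d) (box d a), ∃ w₁ ∈ innerBoundary (zdGraph d) (box d b),
          ∃ t₂ ∈ innerBoundary (zdGraph d) (box d a), ∃ w₂ ∈ innerBoundary (zdGraph d) (box d b),
          ω ∩ {e : Sym2 (Site d) | e ∈ (↑((box d b).sym2) : Set (Sym2 (Site d))) ∧
              ¬ (∀ v ∈ e, v ∈ box d a) ∧ ¬ (∀ v ∈ e, v ∈ innerBoundary (zdGraph d) (box d b))} ∈
            openConnIn (↑(box d b) : Set (Site d)) t₁ w₁ ∧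
          ω ∩ {e : Sym2 (Site d) | e ∈ (↑((box d b).sym2) : Set (Sym2 (Site d))) ∧
              ¬ (∀ v ∈ e, v ∈ box d a) ∧ ¬ (∀ v ∈ e, v ∈ innerBoundary (zdGraph d) (box d b))} ∈
            openConnIn (↑(box d b) : Set (Site d)) t₂ w₂ ∧
          ω ∩ {e : Sym2 (Site d) | e ∈ (↑((box d b).sym2) : Set (Sym2 (Site d))) ∧
              ¬ (∀ v ∈ e, v ∈ box d a) ∧ ¬ (∀ v ∈ e, v ∈ innerBoundary (zdGraph d) (box d b))} ∉
            openConnIn (↑(box d b) : Set (Site d)) w₁ w₂} := by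
  classical
  have hb : 1 ≤ b := by omega
  obtain ⟨t₁, ht₁, w₁, hw₁, t₂, ht₂, w₂, hw₂, h₁, h₂, h₁₂⟩ := h
  have hta : ∀ t ∈ innerBoundary (zdGraph d) (box d a), t ∈ box d (b - 1) := fun t ht =>
    box_mono d (by omega) (Finset.mem_filter.1 ht).1
  have hwb : ∀ w ∈ innerBoundary (zdGraph d) (box d b'), w ∉ box d (b - 1) := fun w hw =>
    notMem_box_of_mem_innerBoundary_box (by omega) hw
  obtain ⟨u₁, hu₁, hp₁, hq₁⟩ := exists_eann_prefix hb hω (hta t₁ ht₁) (hwb w₁ hw₁) h₁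
  obtain ⟨u₂, hu₂, hp₂, hq₂⟩ := exists_eann_prefix hb hω (hta t₂ ht₂) (hwb w₂ hw₂) h₂
  refine ⟨t₁, ht₁, u₁, hu₁, t₂, ht₂, u₂, hu₂, hp₁, hp₂, fun hγ => h₁₂ ?_⟩
  -- `EANN(a,b) ⊆ EANN(a,b')` and `Λ(b) ⊆ Λ(b')`: the joining connection lifts
  have hEE : ω ∩ {e : Sym2 (Site d) | e ∈ (↑((box d b).sym2) : Set (Sym2 (Site d))) ∧
        ¬ (∀ v ∈ e, v ∈ box d a) ∧ ¬ (∀ v ∈ e, v ∈ innerBoundary (zdGraph d) (box d b))} ⊆ ω ∩ {e : Sym2 (Site d) | e ∈ (↑((box d b').sym2) : Set (Sym2 (Site d))) ∧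
        ¬ (∀ v ∈ e, v ∈ box d a) ∧ ¬ (∀ v ∈ e, v ∈ innerBoundary (zdGraph d) (box d b'))} := by
    rintro e ⟨heω, heb, hna, hnb⟩
    refine ⟨heω, ?_, hna, fun hall => ?_⟩
    · exact Finset.mem_coe.2 (Finset.sym2_mono (box_mono d hbb') (Finset.mem_coe.1 heb))
    · induction e using Sym2.ind with
      | h x y =>
        have hx : x ∈ box d b := Finset.mem_sym2_iff.1 (Finset.mem_coe.1 heb) x (Sym2.mem_mk_left x y)
        rcases Nat.lt_or_ge b b' with hlt | hge
        · exact notMem_box_of_mem_innerBoundary_box hlt (hall x (Sym2.mem_mk_left x y)) hx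
        · have hbb : b = b' := le_antisymm hbb' hge
          subst hbb
          exact hnb hall
  have hγ' : ω ∩ {e : Sym2 (Site d) | e ∈ (↑((box d b').sym2) : Set (Sym2 (Site d))) ∧
        ¬ (∀ v ∈ e, v ∈ box d a) ∧ ¬ (∀ v ∈ e, v ∈ innerBoundary (zdGraph d) (box d b'))} ∈ openConnIn (↑(box d b') : Set (Site d)) u₁ u₂ :=
    isUpperSet_openConnIn _ u₁ u₂ hEE (openConnIn_mono (Finset.coe_subset.2 (box_mono d hbb')) u₁ u₂ hγ)
  -- chain `w₁ → t₁ → u₁ → u₂ → t₂ → w₂` through walks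
  have hωE : ω ∩ {e : Sym2 (Site d) | e ∈ (↑((box d b').sym2) : Set (Sym2 (Site d))) ∧
        ¬ (∀ v ∈ e, v ∈ box d a) ∧ ¬ (∀ v ∈ e, v ∈ innerBoundary (zdGraph d) (box d b'))} ⊆ (zdGraph d).edgeSet := fun e he => hω he.1
  obtain ⟨P₁, hP₁S, hP₁E⟩ := exists_walk_of_mem_openConnIn hωE h₁
  obtain ⟨Q₁, hQ₁S, hQ₁E⟩ := exists_walk_of_mem_openConnIn hωE hq₁
  obtain ⟨Γ, hΓS, hΓE⟩ := exists_walk_of_mem_openConnIn hωE hγ'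
  obtain ⟨Q₂, hQ₂S, hQ₂E⟩ := exists_walk_of_mem_openConnIn hωE hq₂
  obtain ⟨P₂, hP₂S, hP₂E⟩ := exists_walk_of_mem_openConnIn hωE h₂
  refine mem_openConnIn_of_walk (P₁.reverse.append (Q₁.append (Γ.append (Q₂.reverse.append P₂)))) (fun z hz => ?_) (fun e he => ?_)
  · simp only [SimpleGraph.Walk.mem_support_append_iff, SimpleGraph.Walk.support_reverse, List.mem_reverse] at hz
    rcases hz with hz | hz | hz | hz | hz
    · exact hP₁S z hz
    · exact hQ₁S z hz
    · exact hΓS z hz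
    · exact hQ₂S z hz
    · exact hP₂S z hz
  · simp only [SimpleGraph.Walk.edges_append, SimpleGraph.Walk.edges_reverse, List.mem_append, List.mem_reverse] at he
    rcases he with he | he | he | he | he
    · exact hP₁E e he
    · exact hQ₁E e he
    · exact hΓE e he
    · exact hQ₂E e he
    · exact hP₂E e he

/-! ## Closing the pairs of `Λ(a)` turns `NONUNIQ(a, c+1)` into a bad pair of the uniqueness zone at radius `c` -/

/-- On a lattice configuration in `NONUNIQ(a, c+1)` (`a ≤ c`) in which every pair of `Λ(a)` is closed, the two inner ends `t₁, t₂ ∈ ∂ⁱⁿΛ(a)`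
form a bad pair at radius `c`: both reach `∂ⁱⁿΛ(c)` inside `Λ(c)`, and an open path joining them inside `Λ(c)` would be an `EANN(a,c+1)`-path
(its pairs are open, hence not pairs of `Λ(a)`, and lie inside `Λ(c)`), joining the two crossings. [cite: BasuSapozhnikov2017ECP, §1 eq. (3) ("(3) implies (A1)", finite-energy direction)] -/
theorem exists_badPair_of_nonuniq_of_closed {a c : ℕ} (hac : a ≤ c) {ω : BondConfig (Site d)} (hω : ω ⊆ (zdGraph d).edgeSet)
    (h : ω ∈
      {ω : BondConfig (Site d) | ∃ t₁ ∈ innerBoundary (zdGraph d) (box d a), ∃ w₁ ∈ innerBoundary (zdGraph d) (box d (c + 1)),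
          ∃ t₂ ∈ innerBoundary (zdGraph d) (box d a), ∃ w₂ ∈ innerBoundary (zdGraph d) (box d (c + 1)),
          ω ∩ {e : Sym2 (Site d) | e ∈ (↑((box d (c + 1)).sym2) : Set (Sym2 (Site d))) ∧
              ¬ (∀ v ∈ e, v ∈ box d a) ∧ ¬ (∀ v ∈ e, v ∈ innerBoundary (zdGraph d) (box d (c + 1)))} ∈
            openConnIn (↑(box d (c + 1)) : Set (Site d)) t₁ w₁ ∧
          ω ∩ {e : Sym2 (Site d) | e ∈ (↑((box d (c + 1)).sym2) : Set (Sym2 (Site d))) ∧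
              ¬ (∀ v ∈ e, v ∈ box d a) ∧ ¬ (∀ v ∈ e, v ∈ innerBoundary (zdGraph d) (box d (c + 1)))} ∈
            openConnIn (↑(box d (c + 1)) : Set (Site d)) t₂ w₂ ∧
          ω ∩ {e : Sym2 (Site d) | e ∈ (↑((box d (c + 1)).sym2) : Set (Sym2 (Site d))) ∧
              ¬ (∀ v ∈ e, v ∈ box d a) ∧ ¬ (∀ v ∈ e, v ∈ innerBoundary (zdGraph d) (box d (c + 1)))} ∉
            openConnIn (↑(box d (c + 1)) : Set (Site d)) w₁ w₂})
    (hcl : ∀ e ∈ (box d a).sym2, e ∉ ω) :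
    ∃ t₁ ∈ innerBoundary (zdGraph d) (box d a), ∃ t₂ ∈ innerBoundary (zdGraph d) (box d a), ω ∈ badPair (d := d) c t₁ t₂ := by
  classical
  obtain ⟨t₁, ht₁, w₁, hw₁, t₂, ht₂, w₂, hw₂, h₁, h₂, h₁₂⟩ := h
  have htc : ∀ t ∈ innerBoundary (zdGraph d) (box d a), t ∈ box d c := fun t ht => box_mono d hac (Finset.mem_filter.1 ht).1
  -- both inner ends reach `∂ⁱⁿΛ(c+1)` inside `Λ(c+1)`, hence `∂ⁱⁿΛ(c)` inside `Λ(c)`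
  have hT : ∀ t ∈ innerBoundary (zdGraph d) (box d a), ∀ w ∈ innerBoundary (zdGraph d) (box d (c + 1)),
      ω ∩ {e : Sym2 (Site d) | e ∈ (↑((box d (c + 1)).sym2) : Set (Sym2 (Site d))) ∧
        ¬ (∀ v ∈ e, v ∈ box d a) ∧ ¬ (∀ v ∈ e, v ∈ innerBoundary (zdGraph d) (box d (c + 1)))} ∈ openConnIn (↑(box d (c + 1)) : Set (Site d)) t w → ω ∈ toBdry c t := by
    intro t ht w hw htw
    exact toBdry_succ_subset (htc t ht) hω ⟨w, hw, isUpperSet_openConnIn _ t w Set.inter_subset_left htw⟩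
  refine ⟨t₁, ht₁, t₂, ht₂, ⟨hT t₁ ht₁ w₁ hw₁ h₁, hT t₂ ht₂ w₂ hw₂ h₂⟩, fun hγ => h₁₂ ?_⟩
  -- an open path `t₁ → t₂` inside `Λ(c)` is an `EANN(a,c+1)`-path
  obtain ⟨γ, hγS, hγE⟩ := exists_walk_of_mem_openConnIn hω hγ
  have hγ' : ω ∩ {e : Sym2 (Site d) | e ∈ (↑((box d (c + 1)).sym2) : Set (Sym2 (Site d))) ∧
        ¬ (∀ v ∈ e, v ∈ box d a) ∧ ¬ (∀ v ∈ e, v ∈ innerBoundary (zdGraph d) (box d (c + 1)))} ∈ openConnIn (↑(box d (c + 1)) : Set (Site d)) t₁ t₂ := by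
    refine mem_openConnIn_of_walk γ (fun z hz => Finset.mem_coe.2 (box_mono d (Nat.le_succ c) (Finset.mem_coe.1 (hγS z hz))))
      (fun e he => ?_)
    induction e using Sym2.ind with
    | h x y =>
      have hx : x ∈ box d c := Finset.mem_coe.1 (hγS x (γ.fst_mem_support_of_mem_edges he))
      have hy : y ∈ box d c := Finset.mem_coe.1 (hγS y (γ.snd_mem_support_of_mem_edges he))
      refine ⟨hγE _ he, Finset.mem_coe.2 (Finset.mem_sym2_iff.2 fun v hv => ?_), fun hall => ?_, fun hall => ?_⟩
      · rcases Sym2.mem_iff.1 hv with rfl | rfl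
        · exact box_mono d (Nat.le_succ c) hx
        · exact box_mono d (Nat.le_succ c) hy
      · exact hcl _ (Finset.mem_sym2_iff.2 hall) (hγE _ he)
      · exact notMem_box_of_mem_innerBoundary_box (Nat.lt_succ_self c) (hall x (Sym2.mem_mk_left x y)) hx
  have h₁' : ω ∩ {e : Sym2 (Site d) | e ∈ (↑((box d (c + 1)).sym2) : Set (Sym2 (Site d))) ∧
        ¬ (∀ v ∈ e, v ∈ box d a) ∧ ¬ (∀ v ∈ e, v ∈ innerBoundary (zdGraph d) (box d (c + 1)))} ∈ openConnIn (↑(box d (c + 1)) : Set (Site d)) w₁ t₁ := by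
    rw [openConnIn_comm]; exact h₁
  exact GM.openConnIn_trans (GM.openConnIn_trans h₁' hγ') h₂

end Summit.CriticalPhenomena.PercolationContinuityZ3.Theorems.Crossing

end
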